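import Mathlib
import HarnessLib
import Summits.HubbardSuperconductivity.HubbardSuperconductivity.Theorems.KLProgrammeKLRegimeEnginePairTransferMemberTowerMasses
import Summits.HubbardSuperconductivity.HubbardSuperconductivity.Theorems.KLProgrammeKLRegimeEnginePairTransferMemberPHProfile
import Summits.HubbardSuperconductivity.HubbardSuperconductivity.Theorems.KLProgrammeKLRegimeEnginePairTransferRelResAnalyticResolvedConvAll

/-!
# Route `KLProgramme` — ENGINE (stmt-HubbardSuperconductivity-20437 `KLRegimeEngineV17F2`), row (c) binder #8: the PLAIN member's resolvent-tower package
# `htower` FROM hsucc-SHAPED ROWS, the member's WEIGHT MASSES DISCHARGED BY THE MODEL — **`klmt_htower_family_profiles`**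
# (cell gate-hubbard-kl, seat hubbard-kl-k3c1-p1 g25, technique «composed-map remainder propagation»; item «ROW-(c)-LADSZ-MASSES» stage 2; sequel of
# `klmt_htower_family_masses` (…MemberTowerMasses) ∘ k3c2-p2's «PH-PROFILE» (`Wd/Wx_member_row_le_profile`, `…_flat_le`, …MemberPHProfile) ∘ `born_row_flat_le` (…MassesFlat); `klrc_if_bound` of …RelResAnalyticResolvedConvAll)

WHY.  `klmt_htower_family_masses` keys the plain member's tower on hsucc-shaped rows at `j = n+1` plus the member's three WEIGHT MASSES `Wd Wx W6` (hypotheses, k3c2-p2's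
currency).  Those masses are MODEL NUMBERS in the tree — the same move rows 71/73 of KLTC-INDEX v12 (…ConvWD / …ConvWDD) made for the pair: `Wd/Wx` by the «PH-PROFILE»
envelope (`Wd/Wx_member_row_le_profile`: flat core `2048·15367 | 1024·15367` below the threshold `G·r < Λₙ₊₁/8`, two-shell tail
`c·(27/8π²)·A·(16/π)(10 + 50Gβ/L)(16384G²·min(r/Λₙ₊₁, Λₙ₊₁/r) + (√2/4)2⁻ⁿ)` above, `G = 4 + (8/3)Gfr₁U²`; FLAT at `n = 0`, located «(X).3-CONV-N0»), `W6` by `born_row_flat_le` +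
`klSoftMass_runningMember_le` (`≤ 1024·15367`), all in the door's normalisation `(Λₙ−Λₙ₊₁)((βL²)³)⁻¹`.  So **`klmt_htower_family_profiles`** = `klmt_htower_family_masses` with
the three mass rows GONE and, in the consumer row, `Wd Wx W6` replaced by the explicit envelopes divided by `(Λₙ−Λₙ₊₁)((βL²)³)⁻¹`; the price is the two-shell REGIME kit of
row 68 (`TwoShellFrameAreaAt A2s u2s`, `U ≤ u2s R`, `π/(4β) ≤ Λₙ₊₁`, `G·(2π/L) ≤ Λₙ₊₁`, `1 ≤ n → 2Λₙ + G·(2π/L) ≤ klE0`), every item of which row (c)'s prefix grants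
(…ClosersVGQDoors: `rowC_hUu`, `rowC_hGL`; `twoShellFrameAreaAt_klTS`; `pi_div_four_mul_le_klScale_of_le_nScales_succ`; `tail_regime_readings`).
Per in-class `Qm` the rows are now: a priori along the slice · history a priori · (F)(i) model row + cap · smallness · kernel sups `0 ≤ M4`, `M4 M6 M2` · `RH₁` / `RL₁` ·
consumer rows — i.e. hsucc's member rows at `j = n+1` (E1 CORE currency) + consumer ARITHMETIC with every weight an explicit model number.
Plumbing + real analysis over landed doors; every row is a HYPOTHESIS of its owner; nothing here asserts (c), any open row of 20437, K3, U₀, the window or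
superconductivity.  0 kit · 0 lit.
-/

noncomputable section

namespace Summit.HubbardSuperconductivity.HubbardSuperconductivity.Theorems.KLRegimeSplit

set_option linter.dupNamespace false -- summit = problem name (single-conjunct summit), D-0017

open Finset Matrix Set Literature.MathematicalPhysics.QuantumLattice Literature.Probability.LatticeModels GrassmannAlgebra
open Summit.HubbardSuperconductivity.HubbardSuperconductivity.Theorems.KLProgrammeLegKernels
open Summit.HubbardSuperconductivity.HubbardSuperconductivity.Theorems.TwoPointAssembly
open Summit.HubbardSuperconductivity.HubbardSuperconductivity.Theorems.DispersionFlow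
open Summit.HubbardSuperconductivity.HubbardSuperconductivity.Theorems.KLRegimeWick
open Summit.HubbardSuperconductivity.HubbardSuperconductivity.Theorems.EngineV8

variable (L M : ℕ) [NeZero L] [NeZero M]

set_option maxHeartbeats 3200000 in -- long pinning equations (h5g″'s hsucc pins) + fourteen-conjunct package; plumbing only
/-- **`klmt_htower_family_profiles`** — the `htower` package (keying `(n, n+1)`, generic bar `Tb` / slot `Bar`) of the PLAIN member from hsucc-shaped rows, the member's
weight masses discharged by the model envelopes (module docstring). -/
theorem klmt_htower_family_profiles {β U μ : ℝ} {n N : ℕ} {m : ℝ} (hm : 0 ≤ m) (hm7 : 3 / 2 * m * 738288 ≤ 1 / 3) {Rn : RenConsts} {G : GeoConsts}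
    (hK : FrameOK Rn U N μ (klFlowFrameU L M β U μ (n + 1))) (hβ : klBetaMin ≤ β) (hβL : β ≤ L) (hG : (2 : ℝ) ^ 19 ≤ G.bhi)
    (hZ : ∀ Λ ∈ Icc (klScale klE0 (n + 1)) (klScale klE0 n), hubbardEffPartitionFnCT L M β U μ 0 (klFlowFrameU L M β U μ (n + 1)) Λ ≠ 0)
    -- the two-shell REGIME kit of the «PH-PROFILE» envelope (row 68 of KLTC-INDEX v12)
    {A2s : ℝ} {u2s : RenConsts → ℝ} (h2s : TwoShellFrameAreaAt A2s u2s) (hA2s : 0 ≤ A2s) (hR : Rn.WF2) (hU : 0 < U) (hUu2 : U ≤ u2s Rn) (hμ : μ ∈ klWindowC)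
    (hj'β : Real.pi / (4 * β) ≤ klScale klE0 (n + 1)) (hGδ : (4 + 8 / 3 * Rn.Gfr 1 * U ^ 2) * (2 * Real.pi / L) ≤ klScale klE0 (n + 1))
    (hE0c : 1 ≤ n → 2 * klScale klE0 n + (4 + 8 / 3 * Rn.Gfr 1 * U ^ 2) * (2 * Real.pi / L) ≤ klE0)
    (A A' : ℕ → TorusSite 2 L → ℝ → Matrix (TorusSite 2 L) (TorusSite 2 L) ℂ) (b b' : ℕ → TorusSite 2 L → ℝ → TorusSite 2 L → ℂ)
    (ρ : ℕ → TorusSite 2 L → TorusSite 2 L → ℝ) (V : ℕ → ℝ → (Fin 4 → HubbardFieldIdx L M) → ℂ) (V6 : ℕ → ℝ → (Fin 6 → HubbardFieldIdx L M) → ℂ)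
    (Sg : ℕ → ℝ → FreqMomentum L M → Fin 2 → ℂ) (Hd : ℕ → ℝ → (Fin 4 → HubbardFieldIdx L M) → ℂ) (Φ : ℕ → ℝ → FreqMomentum L M → ℝ) (Wd : ℝ → FreqMomentum L M → ℝ)
    (Br : ℕ → TorusSite 2 L → ℝ → TorusSite 2 L × MatsubaraIdx M → ℂ)
    (hAdef : A = fun j Qm t => Matrix.of fun k k' : TorusSite 2 L => if k ∈ klBall L μ 0 ∧ k' ∈ klBall L μ 0 then vertexFn L M β (gaussConv ℂ (softCovOf L M β μ (klFlowFrameU L M β U μ (n + 1)) (softSymbolCompl L M β μ (klFlowFrameU L M β U μ (n + 1)) (n + 1) j) + hubbardCovAboveCT L M β μ 0 (klFlowFrameU L M β U μ (n + 1)) (klScale klE0 (n + 1)) - hubbardCovAboveCT L M β μ 0 (klFlowFrameU L M β U μ (n + 1)) (klScale klE0 n + t * (klScale klE0 (n + 1) - klScale klE0 n))) (hubbardEffectiveActionCT L M β U μ 0 (klFlowFrameU L M β U μ (n + 1)) (klScale klE0 n + t * (klScale klE0 (n + 1) - klScale klE0 n)))) 4 ![(((omega0 M, k'), 0), 0), ((((omega0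 M).rev, Qm - k'), 1), 0), ((((omega0 M).rev, Qm - k), 1), 1), (((omega0 M, k), 0), 1)] else 0)
    (hA'def : A' = fun j Qm t => Matrix.of fun k k' : TorusSite 2 L => if k ∈ klBall L μ 0 ∧ k' ∈ klBall L μ 0 then (klScale klE0 (n + 1) - klScale klE0 n) • -((2 : ℂ)⁻¹ * vertexFn L M β (gaussConv ℂ (softCovOf L M β μ (klFlowFrameU L M β U μ (n + 1)) (softSymbolCompl L M β μ (klFlowFrameU L M β U μ (n + 1)) (n + 1) j) + hubbardCovAboveCT L M β μ 0 (klFlowFrameU L M β U μ (n + 1)) (klScale klE0 (n + 1)) - hubbardCovAboveCT L M β μ 0 (klFlowFrameU L M β U μ (n + 1)) (klScale klE0 n + t * (klScale klE0 (n + 1) - klScale klE0 n))) (grassmannDerivPairing ℂ (Matrix.of fun X Y : HubbardFieldIdx L M => deriv (fun Λ'' : ℝ => hubbardCovAboveCT L M β μ 0 (klFlowFrameU L M β U μ (n + 1)) Λ'' X Y) (klScale klE0 n + t * (klScale klE0 (n + 1) - klScale klE0 n))) (hubbardEffectiveActionCT L M β U μ 0 (klFlowFrameU L M β U μ (n + 1))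 (klScale klE0 n + t * (klScale klE0 (n + 1) - klScale klE0 n))) (hubbardEffectiveActionCT L M β U μ 0 (klFlowFrameU L M β U μ (n + 1)) (klScale klE0 n + t * (klScale klE0 (n + 1) - klScale klE0 n))))) 4 ![(((omega0 M, k'), 0), 0), ((((omega0 M).rev, Qm - k'), 1), 0), ((((omega0 M).rev, Qm - k), 1), 1), (((omega0 M, k), 0), 1)]) else 0)
    (hbdef : b = fun j Qm t p => -((klBubbleMass L M β μ (klFlowFrameU L M β U μ (n + 1)) (fun k => (softSymbolCompl L M β μ (klFlowFrameU L M β U μ (n + 1)) (n + 1) j) k + (hubbardCutoffWeightCT L M β μ (klFlowFrameU L M β U μ (n + 1)) (klScale klE0 (n + 1)) k - hubbardCutoffWeightCT L M β μ (klFlowFrameU L M β U μ (n + 1)) (klScale klE0 n + t * (klScale klE0 (n + 1) - klScale klE0 n)) k)) (fun k => (softSymbolCompl L M β μ (klFlowFrameU L M β U μ (n + 1)) (n + 1) j) k + (hubbardCutoffWeightCT L M β μ (klFlowFrameU L M β U μ (n + 1)) (klScale klE0 (n + 1)) k - hubbardCutoffWeightCT L M β μ (klFlowFrameU L M β U μ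 (n + 1)) (klScale klE0 n + t * (klScale klE0 (n + 1) - klScale klE0 n)) k)) Qm p : ℝ) : ℂ))
    (hb'def : b' = fun j Qm t p => (((klScale klE0 (n + 1) - klScale klE0 n) * (klBubbleMass L M β μ (klFlowFrameU L M β U μ (n + 1)) (fun k => deriv (fun Λ' => hubbardCutoffWeightCT L M β μ (klFlowFrameU L M β U μ (n + 1)) Λ' k) (klScale klE0 n + t * (klScale klE0 (n + 1) - klScale klE0 n))) (fun k => (softSymbolCompl L M β μ (klFlowFrameU L M β U μ (n + 1)) (n + 1) j) k + (hubbardCutoffWeightCT L M β μ (klFlowFrameU L M β U μ (n + 1)) (klScale klE0 (n + 1)) k - hubbardCutoffWeightCT L M β μ (klFlowFrameU L M β U μ (n + 1)) (klScale klE0 n + t * (klScale klE0 (n + 1) - klScale klE0 n)) k)) Qm p + klBubbleMass L M β μ (klFlowFrameU L M β U μ (n + 1)) (fun k => (softSymbolCompl L M β μ (klFlowFrameU L M β U μ (n + 1)) (n + 1) j) k + (hubbardCutoffWeightCT L M β μ (klFlowFrameU L M β U μ (n + 1)) (klScale klE0 (n + 1)) k - hubbardCutoffWeightCT L M β μ (klFlowFrameU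 L M β U μ (n + 1)) (klScale klE0 n + t * (klScale klE0 (n + 1) - klScale klE0 n)) k)) (fun k => deriv (fun Λ' => hubbardCutoffWeightCT L M β μ (klFlowFrameU L M β U μ (n + 1)) Λ' k) (klScale klE0 n + t * (klScale klE0 (n + 1) - klScale klE0 n))) Qm p) : ℝ) : ℂ))
    (hρdef : ρ = fun j Qm c => klRungProfile L M β μ (klFlowFrameU L M β U μ (n + 1)) n (softSymbolCompl L M β μ (klFlowFrameU L M β U μ (n + 1)) (n + 1) j) Qm c)
    (hV : V = fun j t X => vertexFn L M β (gaussConv ℂ (softCovOf L M β μ (klFlowFrameU L M β U μ (n + 1)) (softSymbolCompl L M β μ (klFlowFrameU L M β U μ (n + 1)) (n + 1) j) + hubbardCovAboveCT L M β μ 0 (klFlowFrameU L M β U μ (n + 1)) (klScale klE0 (n + 1)) - hubbardCovAboveCT L M β μ 0 (klFlowFrameU L M β U μ (n + 1)) (klScale klE0 n + t * (klScale klE0 (n + 1) - klScale klE0 n))) (hubbardEffectiveActionCT L M β U μ 0 (klFlowFrameU L M β U μ (n + 1)) (klScale klE0 n + t * (klScale klE0 (n + 1) - klScale klE0 n))))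 4 X)
    (hV6 : V6 = fun j t X => vertexFn L M β (gaussConv ℂ (softCovOf L M β μ (klFlowFrameU L M β U μ (n + 1)) (softSymbolCompl L M β μ (klFlowFrameU L M β U μ (n + 1)) (n + 1) j) + hubbardCovAboveCT L M β μ 0 (klFlowFrameU L M β U μ (n + 1)) (klScale klE0 (n + 1)) - hubbardCovAboveCT L M β μ 0 (klFlowFrameU L M β U μ (n + 1)) (klScale klE0 n + t * (klScale klE0 (n + 1) - klScale klE0 n))) (hubbardEffectiveActionCT L M β U μ 0 (klFlowFrameU L M β U μ (n + 1)) (klScale klE0 n + t * (klScale klE0 (n + 1) - klScale klE0 n)))) 6 X)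
    (hSg : Sg = fun j t p σ => selfEnergy L M β (gaussConv ℂ (softCovOf L M β μ (klFlowFrameU L M β U μ (n + 1)) (softSymbolCompl L M β μ (klFlowFrameU L M β U μ (n + 1)) (n + 1) j) + hubbardCovAboveCT L M β μ 0 (klFlowFrameU L M β U μ (n + 1)) (klScale klE0 (n + 1)) - hubbardCovAboveCT L M β μ 0 (klFlowFrameU L M β U μ (n + 1)) (klScale klE0 n + t * (klScale klE0 (n + 1) - klScale klE0 n))) (hubbardEffectiveActionCT L M β U μ 0 (klFlowFrameU L M β U μ (n + 1)) (klScale klE0 n + t * (klScale klE0 (n + 1) - klScale klE0 n)))) p σ)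
    (hHd : Hd = fun j t X => vertexFn L M β (dblFold ℂ (grassmannLaplacian ℂ (crossCov ℂ (Matrix.of fun X Y : HubbardFieldIdx L M => deriv (fun Λ' : ℝ => hubbardCovAboveCT L M β μ 0 (klFlowFrameU L M β U μ (n + 1)) Λ' X Y) (klScale klE0 n + t * (klScale klE0 (n + 1) - klScale klE0 n)))) ((gaussConv ℂ (crossCov ℂ (softCovOf L M β μ (klFlowFrameU L M β U μ (n + 1)) (softSymbolCompl L M β μ (klFlowFrameU L M β U μ (n + 1)) (n + 1) j) + hubbardCovAboveCT L M β μ 0 (klFlowFrameU L M β U μ (n + 1)) (klScale klE0 (n + 1)) - hubbardCovAboveCT L M β μ 0 (klFlowFrameU L M β U μ (n + 1)) (klScale klE0 n + t * (klScale klE0 (n + 1) - klScale klE0 n)))) - grassmannLaplacian ℂ (crossCov ℂ (softCovOf L M β μ (klFlowFrameU L M β U μ (n + 1)) (softSymbolCompl L M β μ (klFlowFrameU L M β U μ (n + 1)) (n + 1) j) + hubbardCovAboveCT L M β μ 0 (klFlowFrameU L M β U μ (n + 1)) (klScale klE0 (n + 1)) - hubbardCovAboveCT L M β μ 0 (klFlowFrameU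 L M β U μ (n + 1)) (klScale klE0 n + t * (klScale klE0 (n + 1) - klScale klE0 n))))) (dblCopy ℂ 0 (gaussConv ℂ (softCovOf L M β μ (klFlowFrameU L M β U μ (n + 1)) (softSymbolCompl L M β μ (klFlowFrameU L M β U μ (n + 1)) (n + 1) j) + hubbardCovAboveCT L M β μ 0 (klFlowFrameU L M β U μ (n + 1)) (klScale klE0 (n + 1)) - hubbardCovAboveCT L M β μ 0 (klFlowFrameU L M β U μ (n + 1)) (klScale klE0 n + t * (klScale klE0 (n + 1) - klScale klE0 n))) (hubbardEffectiveActionCT L M β U μ 0 (klFlowFrameU L M β U μ (n + 1)) (klScale klE0 n + t * (klScale klE0 (n + 1) - klScale klE0 n)))) * dblCopy ℂ 1 (gaussConv ℂ (softCovOf L M β μ (klFlowFrameU L M β U μ (n + 1)) (softSymbolCompl L M β μ (klFlowFrameU L M β U μ (n + 1)) (n + 1) j) + hubbardCovAboveCT L M β μ 0 (klFlowFrameU L M β U μ (n + 1)) (klScale klE0 (n + 1)) - hubbardCovAboveCT L M β μ 0 (klFlowFrameU L M β U μ (n + 1)) (klScale klE0 n + t * (klScale klE0 (n + 1) - klScale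 klE0 n))) (hubbardEffectiveActionCT L M β U μ 0 (klFlowFrameU L M β U μ (n + 1)) (klScale klE0 n + t * (klScale klE0 (n + 1) - klScale klE0 n)))))))) 4 X)
    (hΦ : Φ = fun j t k => (softSymbolCompl L M β μ (klFlowFrameU L M β U μ (n + 1)) (n + 1) j) k + (hubbardCutoffWeightCT L M β μ (klFlowFrameU L M β U μ (n + 1)) (klScale klE0 (n + 1)) k - hubbardCutoffWeightCT L M β μ (klFlowFrameU L M β U μ (n + 1)) (klScale klE0 n + t * (klScale klE0 (n + 1) - klScale klE0 n)) k))
    (hWd : Wd = fun t k => deriv (fun Λ' : ℝ => hubbardCutoffWeightCT L M β μ (klFlowFrameU L M β U μ (n + 1)) Λ' k) (klScale klE0 n + t * (klScale klE0 (n + 1) - klScale klE0 n)))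
    (hBr : Br = fun j Qm t z => -(((((β * (L : ℝ) ^ 2 : ℝ) : ℂ)))⁻¹ * propCT L M β μ (klFlowFrameU L M β U μ (n + 1)) (z.2, z.1) * propCT L M β μ (klFlowFrameU L M β U μ (n + 1)) (z.2.rev, Qm - z.1)) * ((((klScale klE0 (n + 1) - klScale klE0 n) * (-Wd t (z.2, z.1) * Φ j t (z.2.rev, Qm - z.1) - Φ j t (z.2, z.1) * Wd t (z.2.rev, Qm - z.1))) : ℝ) : ℂ))
    (Tb Bar : TorusSite 2 L → TorusSite 2 L → TorusSite 2 L → ℝ)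
    (hrows : ∀ Qm : TorusSite 2 L, IsPairClassAt L Qm (n + 1) →
      ∃ (r' e₁ M4 M6 M2 : ℝ) (η E₁ RH RL : TorusSite 2 L → TorusSite 2 L → ℝ), 0 ≤ r' ∧ 0 ≤ e₁ ∧
        -- a priori along the slice; history a priori [class #1]
        (∀ t ∈ Icc (0 : ℝ) 1, ∀ x y, ‖A (n + 1) Qm t x y‖ ≤ m) ∧
        (∀ x y, ‖klMemberArrayF L M β U μ n (softSymbolCompl L M β μ (klFlowFrameU L M β U μ n) n (n + 1)) Qm x y‖ ≤ m) ∧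
        -- (F)(i): majorant of the FRAME SHIFT `K_n → K_(n+1)` of the history member (model objects) + its scalar cap [k3c2-p2]
        (∀ x y, ‖((Matrix.of fun k k' : TorusSite 2 L => if k ∈ klBall L μ 0 ∧ k' ∈ klBall L μ 0 then klCovSmearedPairAmplitude L M β U μ (klFlowFrameU L M β U μ (n + 1)) n (softCovOf L M β μ (klFlowFrameU L M β U μ (n + 1)) (softSymbolCompl L M β μ (klFlowFrameU L M β U μ (n + 1)) n (n + 1))) Qm k k' else 0) - klMemberArrayF L M β U μ n (softSymbolCompl L M β μ (klFlowFrameU L M β U μ n) n (n + 1)) Qm) x y‖ ≤ η x y) ∧ (∀ x y, η x y ≤ r') ∧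
        -- smallness of the NAMED tower weight
        (3 / 2 * m + r') * ∑ p, |klSliceWeightSmeared L M β μ (klFlowFrameU L M β U μ (n + 1)) (n + 1) (fun _ => (0 : ℝ)) Qm p| ≤ 1 / 3 ∧
        -- class-#1 kernel sups along the slice (4-point / 6-point / self-energy pins of the member carrier)
        0 ≤ M4 ∧ (∀ t ∈ Icc (0 : ℝ) 1, ∀ X, ‖V (n + 1) t X‖ ≤ M4) ∧ (∀ t ∈ Icc (0 : ℝ) 1, ∀ X, ‖V6 (n + 1) t X‖ ≤ M6) ∧ (∀ t ∈ Icc (0 : ℝ) 1, ∀ p σ, ‖Sg (n + 1) t p σ‖ ≤ M2) ∧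
        -- the «≥ 2 cross lines» class row and the localisation row (hsucc's `RH₁` / `RL₁` at `j = n+1`)
        (∀ t ∈ Icc (0 : ℝ) 1, ∀ x y : TorusSite 2 L, ‖Hd (n + 1) t ![(((omega0 M, y), 0), 0), ((((omega0 M).rev, Qm - y), 1), 0), ((((omega0 M).rev, Qm - x), 1), 1), (((omega0 M, x), 0), 1)]‖ ≤ RH x y) ∧
        (∀ t ∈ Icc (0 : ℝ) 1, ∀ x y : TorusSite 2 L, ‖∑ z : TorusSite 2 L × MatsubaraIdx M, Br (n + 1) Qm t z * ((if z.1 ∈ klBall L μ 0 then V (n + 1) t ![(((omega0 M, z.1), 0), 0), ((((omega0 M).rev, Qm - z.1), 1), 0), ((((omega0 M).rev, Qm - x), 1), 1), (((omega0 M, x), 0), 1)] * V (n + 1) t ![(((omega0 M, y), 0), 0), ((((omega0 M).rev, Qm - y), 1), 0), ((((omega0 M).rev, Qm - z.1), 1), 1), (((omega0 M, z.1), 0), 1)] else 0) - V (n + 1) t ![(((z.2, z.1), 0), 0), (((z.2.rev, Qm - z.1), 1), 0), ((((omega0 M).rev, Qm - x), 1), 1), (((omega0 M, x), 0), 1)]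 * V (n + 1) t ![(((omega0 M, y), 0), 0), ((((omega0 M).rev, Qm - y), 1), 0), (((z.2.rev, Qm - z.1), 1), 1), (((z.2, z.1), 0), 1)])‖ ≤ RL x y) ∧
        -- consumer-side rows at the bar `Tb Qm` and the slot `Bar Qm`; the source majorant `FT_ρ[J] + FT_w[η]` is WRITTEN OUT, the member's three weight masses
        -- replaced by their MODEL envelopes («PH-PROFILE» flat core / two-shell tail, flat at `n = 0`; born flat)
        (∀ x y, Tb Qm x y ≤ r') ∧
        (∀ x y, ((((klScale klE0 n - klScale klE0 (n + 1)) * (2⁻¹ * RH x y + ((β * (L : ℝ) ^ 2) ^ 3)⁻¹ * (M4 * M4 * ((if n = 0 then (2048 * 15367 : ℝ) else if (4 + 8 / 3 * Rn.Gfr 1 * U ^ 2) * klTorusNorm L (x - y) < klScale klE0 (n + 1) / 8 then 2048 * 15367 else 512 / 3 * (27 / (8 * Real.pi ^ 2)) * A2s * (16 / Real.pi) * (10 + 50 * (4 + 8 / 3 * Rn.Gfr 1 * U ^ 2) * β / L) * (16384 * (4 + 8 / 3 * Rn.Gfr 1 * U ^ 2) ^ 2 * min (klTorusNorm L (x - y)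 / klScale klE0 (n + 1)) (klScale klE0 (n + 1) / klTorusNorm L (x - y)) + Real.sqrt 2 / 4 * ((2 : ℝ) ^ n)⁻¹)) / ((klScale klE0 n - klScale klE0 (n + 1)) * ((β * (L : ℝ) ^ 2) ^ 3)⁻¹)) + M4 * M4 * ((if n = 0 then (1024 * 15367 : ℝ) else if (4 + 8 / 3 * Rn.Gfr 1 * U ^ 2) * klTorusNorm L (x + y - Qm) < klScale klE0 (n + 1) / 8 then 1024 * 15367 else 256 / 3 * (27 / (8 * Real.pi ^ 2)) * A2s * (16 / Real.pi) * (10 + 50 * (4 + 8 / 3 * Rn.Gfr 1 * U ^ 2) * β / L) * (16384 * (4 + 8 / 3 * Rn.Gfr 1 * U ^ 2) ^ 2 * min (klTorusNorm L (x + y - Qm) / klScale klE0 (n + 1)) (klScale klE0 (n + 1) / klTorusNorm L (x + y - Qm)) + Real.sqrt 2 / 4 * ((2 : ℝ) ^ n)⁻¹)) / ((klScale klE0 n - klScale klE0 (n + 1)) * ((β * (L : ℝ) ^ 2) ^ 3)⁻¹)) + 2 * (M6 * M2 * ((1024 * 15367 : ℝ) / ((klScale klE0 n - klScale klE0 (n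 + 1)) * ((β * (L : ℝ) ^ 2) ^ 3)⁻¹))))) + RL x y) + 3 / 2 * (3 / 2 * m) * ∑ c, ((klScale klE0 n - klScale klE0 (n + 1)) * (2⁻¹ * RH x c + ((β * (L : ℝ) ^ 2) ^ 3)⁻¹ * (M4 * M4 * ((if n = 0 then (2048 * 15367 : ℝ) else if (4 + 8 / 3 * Rn.Gfr 1 * U ^ 2) * klTorusNorm L (x - c) < klScale klE0 (n + 1) / 8 then 2048 * 15367 else 512 / 3 * (27 / (8 * Real.pi ^ 2)) * A2s * (16 / Real.pi) * (10 + 50 * (4 + 8 / 3 * Rn.Gfr 1 * U ^ 2) * β / L) * (16384 * (4 + 8 / 3 * Rn.Gfr 1 * U ^ 2) ^ 2 * min (klTorusNorm L (x - c) / klScale klE0 (n + 1)) (klScale klE0 (n + 1) / klTorusNorm L (x - c)) + Real.sqrt 2 / 4 * ((2 : ℝ) ^ n)⁻¹)) / ((klScale klE0 n - klScale klE0 (n + 1)) * ((β * (L : ℝ) ^ 2) ^ 3)⁻¹)) + M4 * M4 * ((if n = 0 then (1024 * 15367 : ℝ) else if (4 + 8 / 3 * Rn.Gfr 1 * U ^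 2) * klTorusNorm L (x + c - Qm) < klScale klE0 (n + 1) / 8 then 1024 * 15367 else 256 / 3 * (27 / (8 * Real.pi ^ 2)) * A2s * (16 / Real.pi) * (10 + 50 * (4 + 8 / 3 * Rn.Gfr 1 * U ^ 2) * β / L) * (16384 * (4 + 8 / 3 * Rn.Gfr 1 * U ^ 2) ^ 2 * min (klTorusNorm L (x + c - Qm) / klScale klE0 (n + 1)) (klScale klE0 (n + 1) / klTorusNorm L (x + c - Qm)) + Real.sqrt 2 / 4 * ((2 : ℝ) ^ n)⁻¹)) / ((klScale klE0 n - klScale klE0 (n + 1)) * ((β * (L : ℝ) ^ 2) ^ 3)⁻¹)) + 2 * (M6 * M2 * ((1024 * 15367 : ℝ) / ((klScale klE0 n - klScale klE0 (n + 1)) * ((β * (L : ℝ) ^ 2) ^ 3)⁻¹))))) + RL x c) * ρ (n + 1) Qm c + 3 / 2 * m * ∑ a, ρ (n + 1) Qm a * ((klScale klE0 n - klScale klE0 (n + 1)) * (2⁻¹ * RH a y + ((β * (L : ℝ) ^ 2) ^ 3)⁻¹ * (M4 * M4 * ((if n = 0 then (2048 * 15367 : ℝ) else if (4 + 8 / 3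 * Rn.Gfr 1 * U ^ 2) * klTorusNorm L (a - y) < klScale klE0 (n + 1) / 8 then 2048 * 15367 else 512 / 3 * (27 / (8 * Real.pi ^ 2)) * A2s * (16 / Real.pi) * (10 + 50 * (4 + 8 / 3 * Rn.Gfr 1 * U ^ 2) * β / L) * (16384 * (4 + 8 / 3 * Rn.Gfr 1 * U ^ 2) ^ 2 * min (klTorusNorm L (a - y) / klScale klE0 (n + 1)) (klScale klE0 (n + 1) / klTorusNorm L (a - y)) + Real.sqrt 2 / 4 * ((2 : ℝ) ^ n)⁻¹)) / ((klScale klE0 n - klScale klE0 (n + 1)) * ((β * (L : ℝ) ^ 2) ^ 3)⁻¹)) + M4 * M4 * ((if n = 0 then (1024 * 15367 : ℝ) else if (4 + 8 / 3 * Rn.Gfr 1 * U ^ 2) * klTorusNorm L (a + y - Qm) < klScale klE0 (n + 1) / 8 then 1024 * 15367 else 256 / 3 * (27 / (8 * Real.pi ^ 2)) * A2s * (16 / Real.pi) * (10 + 50 * (4 + 8 / 3 * Rn.Gfr 1 * U ^ 2) * β / L) * (16384 * (4 + 8 / 3 * Rn.Gfr 1 * U ^ 2) ^ 2 * min (klTorusNorm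 L (a + y - Qm) / klScale klE0 (n + 1)) (klScale klE0 (n + 1) / klTorusNorm L (a + y - Qm)) + Real.sqrt 2 / 4 * ((2 : ℝ) ^ n)⁻¹)) / ((klScale klE0 n - klScale klE0 (n + 1)) * ((β * (L : ℝ) ^ 2) ^ 3)⁻¹)) + 2 * (M6 * M2 * ((1024 * 15367 : ℝ) / ((klScale klE0 n - klScale klE0 (n + 1)) * ((β * (L : ℝ) ^ 2) ^ 3)⁻¹))))) + RL a y) + 9 / 4 * m * (3 / 2 * m) * ∑ a, ∑ c, ρ (n + 1) Qm a * ((klScale klE0 n - klScale klE0 (n + 1)) * (2⁻¹ * RH a c + ((β * (L : ℝ) ^ 2) ^ 3)⁻¹ * (M4 * M4 * ((if n = 0 then (2048 * 15367 : ℝ) else if (4 + 8 / 3 * Rn.Gfr 1 * U ^ 2) * klTorusNorm L (a - c) < klScale klE0 (n + 1) / 8 then 2048 * 15367 else 512 / 3 * (27 / (8 * Real.pi ^ 2)) * A2s * (16 / Real.pi) * (10 + 50 * (4 + 8 / 3 * Rn.Gfr 1 * U ^ 2) * β / L) * (16384 * (4 + 8 / 3 * Rn.Gfr 1 * U ^ 2)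 ^ 2 * min (klTorusNorm L (a - c) / klScale klE0 (n + 1)) (klScale klE0 (n + 1) / klTorusNorm L (a - c)) + Real.sqrt 2 / 4 * ((2 : ℝ) ^ n)⁻¹)) / ((klScale klE0 n - klScale klE0 (n + 1)) * ((β * (L : ℝ) ^ 2) ^ 3)⁻¹)) + M4 * M4 * ((if n = 0 then (1024 * 15367 : ℝ) else if (4 + 8 / 3 * Rn.Gfr 1 * U ^ 2) * klTorusNorm L (a + c - Qm) < klScale klE0 (n + 1) / 8 then 1024 * 15367 else 256 / 3 * (27 / (8 * Real.pi ^ 2)) * A2s * (16 / Real.pi) * (10 + 50 * (4 + 8 / 3 * Rn.Gfr 1 * U ^ 2) * β / L) * (16384 * (4 + 8 / 3 * Rn.Gfr 1 * U ^ 2) ^ 2 * min (klTorusNorm L (a + c - Qm) / klScale klE0 (n + 1)) (klScale klE0 (n + 1) / klTorusNorm L (a + c - Qm)) + Real.sqrt 2 / 4 * ((2 : ℝ) ^ n)⁻¹)) / ((klScale klE0 n - klScale klE0 (n + 1)) * ((β * (L : ℝ) ^ 2) ^ 3)⁻¹)) + 2 * (M6 * M2 * ((1024 * 15367 : ℝ)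 / ((klScale klE0 n - klScale klE0 (n + 1)) * ((β * (L : ℝ) ^ 2) ^ 3)⁻¹))))) + RL a c) * ρ (n + 1) Qm c) +
            (η x y + 3 / 2 * (3 / 2 * m) * ∑ t, η x t * |klSliceWeightSmeared L M β μ (klFlowFrameU L M β U μ (n + 1)) (n + 1) (fun _ => (0 : ℝ)) Qm t| + 3 / 2 * (3 / 2 * m + r') * ∑ a, |klSliceWeightSmeared L M β μ (klFlowFrameU L M β U μ (n + 1)) (n + 1) (fun _ => (0 : ℝ)) Qm a| * η a y + 9 / 4 * (3 / 2 * m + r') * (3 / 2 * m) * ∑ a, ∑ t, |klSliceWeightSmeared L M β μ (klFlowFrameU L M β U μ (n + 1)) (n + 1) (fun _ => (0 : ℝ)) Qm a| * η a t * |klSliceWeightSmeared L M β μ (klFlowFrameU L M β U μ (n + 1)) (n + 1) (fun _ => (0 : ℝ)) Qm t|)) +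
          (Tb Qm x y + 3 / 2 * (3 / 2 * m) * ∑ t, Tb Qm x t * |klSliceWeightSmeared L M β μ (klFlowFrameU L M β U μ (n + 1)) (n + 1) (fun _ => (0 : ℝ)) Qm t| + 3 / 2 * (3 / 2 * m + r') * ∑ a, |klSliceWeightSmeared L M β μ (klFlowFrameU L M β U μ (n + 1)) (n + 1) (fun _ => (0 : ℝ)) Qm a| * Tb Qm a y + 9 / 4 * (3 / 2 * m + r') * (3 / 2 * m) * ∑ a, ∑ t, |klSliceWeightSmeared L M β μ (klFlowFrameU L M β U μ (n + 1)) (n + 1) (fun _ => (0 : ℝ)) Qm a| * Tb Qm a t * |klSliceWeightSmeared L M β μ (klFlowFrameU L M β U μ (n + 1)) (n + 1) (fun _ => (0 : ℝ)) Qm t|) ≤ E₁ x y) ∧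
        (∀ x y, E₁ x y ≤ e₁) ∧
        (∀ k ∈ klBall L μ 0, ∀ k' ∈ klBall L μ 0, E₁ k k' ≤ Bar Qm k k')) :
    ∀ Qm : TorusSite 2 L, IsPairClassAt L Qm (n + 1) →
      ∃ (X Nm : Matrix (TorusSite 2 L) (TorusSite 2 L) ℂ) (w₁ : TorusSite 2 L → ℝ) (Ea E₁ : TorusSite 2 L → TorusSite 2 L → ℝ) (r' e₁ : ℝ),
        0 ≤ r' ∧ 0 ≤ e₁ ∧
        (∀ x y, ¬(x ∈ klBall L μ 0 ∧ y ∈ klBall L μ 0) → X x y = 0) ∧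
        (∀ k ∈ klBall L μ 0, ∀ k' ∈ klBall L μ 0,
          X k k' = klCovSmearedPairAmplitude L M β U μ (klFlowFrameU L M β U μ n) n
            (softCovOf L M β μ (klFlowFrameU L M β U μ n) (softSymbolCompl L M β μ (klFlowFrameU L M β U μ n) n (n + 1))) Qm k k') ∧
        (∀ x y, 0 ≤ Ea x y) ∧
        (1 + Matrix.diagonal (fun p => (w₁ p : ℂ)) * X) * Nm = 1 ∧
        (∀ k ∈ klBall L μ 0, ∀ k' ∈ klBall L μ 0, ‖klPairArrayF L M β U μ (n + 1) Qm k k' - (X * Nm) k k'‖ ≤ Ea k k') ∧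
        (∀ x y, Tb Qm x y ≤ r') ∧
        (∀ x y, Ea x y + (Tb Qm x y + 3 / 2 * (3 / 2 * m) * ∑ t, Tb Qm x t * |w₁ t| + 3 / 2 * (3 / 2 * m + r') * ∑ a, |w₁ a| * Tb Qm a y +
            9 / 4 * (3 / 2 * m + r') * (3 / 2 * m) * ∑ a, ∑ t, |w₁ a| * Tb Qm a t * |w₁ t|) ≤ E₁ x y) ∧
        (∀ x y, E₁ x y ≤ e₁) ∧
        (3 / 2 * m + r') * ∑ a, |w₁ a| ≤ 1 / 3 ∧
        (∑ p, |w₁ p| ≤ 3 / 4 * G.bhi) ∧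
        (∑ p, (|w₁ p| - w₁ p) ≤ klEdge G (n + 1) (klTorusNorm L Qm)) ∧
        (∀ k ∈ klBall L μ 0, ∀ k' ∈ klBall L μ 0, E₁ k k' ≤ Bar Qm k k')  := by
  have hβ0 : 0 < β := pos_of_klBetaMin_le hβ
  have hΛd : 0 < (klScale klE0 n - klScale klE0 (n + 1)) * ((β * (L : ℝ) ^ 2) ^ 3)⁻¹ := by
    have hΛ : 0 < klScale klE0 n := klth_klScale_pos n
    have hL0 : (0 : ℝ) < L := Nat.cast_pos.2 (Nat.pos_of_ne_zero (NeZero.ne L))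
    have hs : klScale klE0 (n + 1) = klScale klE0 n / 4 := klth_klScale_succ n
    exact mul_pos (by rw [hs]; linarith) (by positivity)
  -- the doors' rows speak the PINNED symbols `Φ`, `Wd`; the profile lemmas the literal ones
  subst hΦ hWd
  refine klmt_htower_family_masses L M hm hm7 hK hβ hβL hG hZ A A' b b' ρ V V6 Sg Hd _ _ Br hAdef hA'def hbdef hb'def hρdef hV hV6 hSg hHd rfl rfl hBr Tb Bar ?_
  intro Qm hQm
  obtain ⟨r', e₁, M4, M6, M2, η, E₁, RH, RL, hr', he₁, hAm, hXm, hη, hηe, hsm₁, hM40, hM4, hM6, hM2, hRH, hRL, hTb, hE₁, hE₁e, hbar⟩ := hrows Qm hQm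
  clear hrows
  -- the member's PH masses as PROFILES IN THE TRANSFER (flat at `n = 0`) and the born mass, flat
  have hWdm := fun t (ht : t ∈ Icc (0 : ℝ) 1) (x y : TorusSite 2 L) => (le_div_iff₀' hΛd).2 (klrc_if_bound
    (Wd_member_row_flat_le (M := M) β μ (klFlowFrameU L M β U μ (n + 1)) hK hβ hβL n (le_refl (n + 1)) ht x y) fun hn1 =>
    Wd_member_row_le_profile (M := M) β μ (klFlowFrameU L M β U μ (n + 1)) h2s hA2s hR hU hUu2 hμ hK hβ hβL n (le_refl (n + 1)) hj'β ht hGδ (hE0c hn1) x y)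
  have hWxm := fun t (ht : t ∈ Icc (0 : ℝ) 1) (x y : TorusSite 2 L) => (le_div_iff₀' hΛd).2 (klrc_if_bound
    (Wx_member_row_flat_le (M := M) β μ (klFlowFrameU L M β U μ (n + 1)) hK hβ hβL n (le_refl (n + 1)) ht Qm x y) fun hn1 =>
    Wx_member_row_le_profile (M := M) β μ (klFlowFrameU L M β U μ (n + 1)) h2s hA2s hR hU hUu2 hμ hK hβ hβL n (le_refl (n + 1)) hj'β ht hGδ (hE0c hn1) Qm x y)
  have hW6m := fun t (ht : t ∈ Icc (0 : ℝ) 1) => (le_div_iff₀' hΛd).2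
    ((born_row_flat_le β μ (klFlowFrameU L M β U μ (n + 1)) hβ0 n ht _).trans (mul_le_mul_of_nonneg_left
      (klSoftMass_runningMember_le (L := L) (M := M) β μ (klFlowFrameU L M β U μ (n + 1)) hK hβ hβL n (le_refl (n + 1)) ht) (by norm_num : (0 : ℝ) ≤ 1024)))
  exact ⟨r', e₁, M4, M6, M2, _, η, E₁, RH, RL, _, _, hr', he₁, hAm, hXm, hη, hηe, hsm₁, hM40, hM4, hM6, hM2, hRH, hRL, hWdm, hWxm, hW6m, hTb, hE₁, hE₁e, hbar⟩

end Summit.HubbardSuperconductivity.HubbardSuperconductivity.Theorems.KLRegimeSplit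

end
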